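import Summits.ResolutionOfSingularities.ResolutionOfSingularities.Theorems.FrobeniusClosingDefs
import Literature.AlgebraicGeometry.Resolution.FiniteDeterminacy
import Literature.RingTheory.MvPowerSeries.MaximalIdealPow

/-!
# Route `FrobeniusClosing`, crux `ClosingReduction`, line `chart-factorization`:
# stub `stub_determinacy` — pair determinacy from Boubakri–Greuel–Markwig Thm 2.1

`PairDeterminacy` (file `Theorems/FrobeniusClosingDefs.lean`): for `p` prime, `n ≥ 2`, `K`
algebraically closed, a multiplicity-`p` state `c` with the Loewy bound `𝔪^β ≤ jac c` is
pair-isomorphic to every state `c'` whose cleaned coefficients agree with those of `c` in all total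
degrees `≤ 2β`. It is the vendored named fact
`Literature.AlgebraicGeometry.Resolution.BoubakriGreuelMarkwig.Thm21` (Boubakri–Greuel–Markwig,
Rev. Mat. Complut. 25 (2012), Thm 2.1(1); unproved, taken as the hypothesis `h21`) transported to
the route's vocabulary:

1. the route's coefficient-formula derivative `pd` is the tree's derivation `MvPowerSeries.pderiv`,
   so `jac c = j(ser c)` and `JacPow β c` reads `𝔪^β ≤ j(f)` for `f := ser c`
   (`DeterminacyProof.pd_eq_pderiv`, `DeterminacyProof.jac_eq_jacobianIdeal`);
2. `f ≠ 0` and every coefficient of `f` of degree `< p` vanishes (`MultP`), so `f ∈ 𝔪²` and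
   `ord f ≥ 2` (jets lemma `mem_maximalIdeal_pow_of_coeff_eq_zero`, `MvPowerSeries.nat_le_order`);
3. `𝔪^{β+2} = 𝔪²·𝔪^β ≤ 𝔪²·j(f)`, so Thm 2.1(1) with `k = β` makes `f` right
   `(2β+2-ord f)`-determined;
4. `f - ser c' ∈ 𝔪^{2β+1} ≤ 𝔪^{2β+2-ord f+1}` (the cleaned coefficients agree in degrees `≤ 2β`);
5. a right equivalence `f = φ(ser c')` is the pair isomorphism `(φ⁻¹, v = 1, g = 0)`.
-/

noncomputable section

-- single-problem summit: the doubled namespace component is forced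
set_option linter.dupNamespace false

open scoped BigOperators Classical

open IsLocalRing
open Literature.AlgebraicGeometry.Resolution
open Literature.RingTheory.MvPowerSeries.Jets

namespace Summit.ResolutionOfSingularities.ResolutionOfSingularities.Theorems.FrobeniusClosing

namespace DeterminacyProof

/-- The coefficients of the cleaned series `ser c` are the cleaned coefficients of `c`.
[folklore] -/
theorem coeff_ser (p n : ℕ) (K : Type) [Field K] (c : (Fin n → ℕ) → K) (e : Fin n →₀ ℕ) :
    MvPowerSeries.coeff e (ser p n K c) = clean p n K c ⇑e :=
  rfl

/-- The route's formal partial derivative `pd i` (coefficient formula `(Aᵢ+1)·f(A+eᵢ)`) is the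
tree's derivation `∂/∂uᵢ`. [folklore] -/
theorem pd_eq_pderiv (n : ℕ) (K : Type) [Field K] (i : Fin n) (f : MvPowerSeries (Fin n) K) :
    pd n K i f = MvPowerSeries.pderiv i f := by
  ext e
  rw [MvPowerSeries.coeff_pderiv, ← Nat.cast_succ]
  rfl

/-- The route's Jacobian ideal `jac c` is the Jacobian ideal `j(ser c)` of
Boubakri–Greuel–Markwig. [folklore] -/
theorem jac_eq_jacobianIdeal (p n : ℕ) (K : Type) [Field K] (c : (Fin n → ℕ) → K) :
    jac p n K c = BoubakriGreuelMarkwig.jacobianIdeal (ser p n K c) := by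
  unfold jac BoubakriGreuelMarkwig.jacobianIdeal
  simp only [pd_eq_pderiv]

/-- A multiplicity-`p` state has a non-zero cleaned series. [folklore] -/
theorem ser_ne_zero {p n : ℕ} {K : Type} [Field K] {c : (Fin n → ℕ) → K} (hM : MultP p n K c) :
    ser p n K c ≠ 0 := by
  obtain ⟨A, hA⟩ := hM.1
  intro h0
  apply hA
  have h := coeff_ser p n K c (Finsupp.equivFunOnFinite.symm A)
  rw [h0, MvPowerSeries.coeff_zero, Finsupp.coe_equivFunOnFinite_symm] at h
  exact h.symm

/-- For a multiplicity-`p` state, every coefficient of the cleaned series of total degree `< p`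
vanishes. [folklore] -/
theorem coeff_ser_eq_zero_of_degree_lt {p n : ℕ} {K : Type} [Field K] {c : (Fin n → ℕ) → K}
    (hM : MultP p n K c) {e : Fin n →₀ ℕ} (he : e.degree < p) :
    MvPowerSeries.coeff e (ser p n K c) = 0 := by
  by_contra hne
  rw [coeff_ser] at hne
  have h := hM.2 ⇑e hne
  rw [← Finsupp.degree_eq_sum] at h
  omega

/-- For a multiplicity-`p` state (`p ≥ 2`), the order `ord (ser c)` of Boubakri–Greuel–Markwig is
at least `2`. [folklore] -/
theorem two_le_ord_ser {p n : ℕ} (hp : p.Prime) {K : Type} [Field K] {c : (Fin n → ℕ) → K}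
    (hM : MultP p n K c) : 2 ≤ BoubakriGreuelMarkwig.ord (ser p n K c) := by
  have h2 : ((2 : ℕ) : ℕ∞) ≤ MvPowerSeries.order (ser p n K c) :=
    MvPowerSeries.nat_le_order fun e he =>
      coeff_ser_eq_zero_of_degree_lt hM (lt_of_lt_of_le he hp.two_le)
  have hne : MvPowerSeries.order (ser p n K c) ≠ ⊤ := by
    rw [Ne, MvPowerSeries.order_eq_top_iff]
    exact ser_ne_zero hM
  obtain ⟨m, hm⟩ := ENat.ne_top_iff_exists.mp hne
  unfold BoubakriGreuelMarkwig.ord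
  rw [← hm] at h2 ⊢
  rw [ENat.toNat_coe]
  exact_mod_cast h2

end DeterminacyProof

open DeterminacyProof in
/-- **Pair determinacy (`n ≥ 2`, `K` algebraically closed) from Boubakri–Greuel–Markwig
Thm 2.1(1).** Given the named fact `Thm21`: a multiplicity-`p` state `c` with the Loewy bound
`𝔪^β ≤ jac c` is pair-isomorphic to every state `c'` whose cleaned coefficients agree with those
of `c` in all total degrees `≤ 2β` (`𝔪^{β+2} ≤ 𝔪²·j(ser c)` makes `ser c` right
`(2β+2-ord)`-determined with `ord ≥ p ≥ 2`, `ser c - ser c' ∈ 𝔪^{2β+1}`, and a right equivalence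
`ser c = φ(ser c')` is the pair isomorphism `(φ⁻¹, 1, 0)`).
[cite: BoubakriGreuelMarkwig2010, Thm. 2.1] -/
theorem stub_determinacy (h21 : BoubakriGreuelMarkwig.Thm21) : PairDeterminacy := by
  intro p hp n β K _ _ c c' hn hJ hM hagree
  -- (2) `f := ser c ≠ 0`, `f ∈ 𝔪²`, `ord f ≥ 2`
  have hf0 : ser p n K c ≠ 0 := ser_ne_zero hM
  have hf2 : ser p n K c ∈ maximalIdeal (MvPowerSeries (Fin n) K) ^ 2 :=
    mem_maximalIdeal_pow_of_coeff_eq_zero fun e he =>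
      coeff_ser_eq_zero_of_degree_lt hM (lt_of_lt_of_le he hp.two_le)
  have hord : 2 ≤ BoubakriGreuelMarkwig.ord (ser p n K c) := two_le_ord_ser hp hM
  -- (1) + (3): `𝔪^{β+2} = 𝔪²·𝔪^β ≤ 𝔪²·jac c = 𝔪²·j(f)`, so Thm 2.1(1) applies with `k = β`
  have hJ' : maximalIdeal (MvPowerSeries (Fin n) K) ^ β ≤ jac p n K c := hJ
  have hhyp : maximalIdeal (MvPowerSeries (Fin n) K) ^ (β + 2) ≤
      maximalIdeal (MvPowerSeries (Fin n) K) ^ 2 *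
        BoubakriGreuelMarkwig.jacobianIdeal (ser p n K c) := by
    rw [show β + 2 = 2 + β from add_comm β 2, pow_add, ← jac_eq_jacobianIdeal]
    exact Ideal.mul_mono_right hJ'
  have hdet : BoubakriGreuelMarkwig.IsRightDetermined
      (2 * β + 2 - BoubakriGreuelMarkwig.ord (ser p n K c)) (ser p n K c) :=
    (h21 K n hn (ser p n K c) β hf0 hf2).1 hhyp
  -- (4) `ser c'` has the same `(2β+2-ord f)`-jet as `f`
  have hmem : ser p n K c - ser p n K c' ∈ maximalIdeal (MvPowerSeries (Fin n) K) ^ (2 * β + 1) := by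
    refine mem_maximalIdeal_pow_of_coeff_eq_zero fun e he => ?_
    rw [map_sub, coeff_ser, coeff_ser, sub_eq_zero]
    refine hagree ⇑e ?_
    rw [← Finsupp.degree_eq_sum]
    omega
  have hjet : BoubakriGreuelMarkwig.HaveSameJet
      (2 * β + 2 - BoubakriGreuelMarkwig.ord (ser p n K c)) (ser p n K c) (ser p n K c') := by
    unfold BoubakriGreuelMarkwig.HaveSameJet
    exact Ideal.pow_le_pow_right (by omega) hmem
  -- (5) a right equivalence is a pair isomorphism with `v = 1`, `g = 0`
  obtain ⟨φ, hφ⟩ := hdet (ser p n K c') hjet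
  refine ⟨φ.symm, 1, 0, isUnit_one, ?_⟩
  rw [hφ, AlgEquiv.symm_apply_apply, one_pow, one_mul, zero_pow hp.ne_zero, add_zero]

end Summit.ResolutionOfSingularities.ResolutionOfSingularities.Theorems.FrobeniusClosing

end
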